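import Summits.ResolutionOfSingularities.ResolutionOfSingularities.Theorems.EquisingularLiftEquisingularLiftNatRegularOfFlatModel
import Summits.ResolutionOfSingularities.ResolutionOfSingularities.Theorems.EquisingularLiftEquisingularLiftNatConeRoundCartier
import Literature.AlgebraicGeometry.Resolution.StrictTransformDistinct
import Literature.AlgebraicGeometry.Resolution.AlterationsSectionDivisor
import Literature.AlgebraicGeometry.Resolution.SpreadRestrict
import Summits.ResolutionOfSingularities.ResolutionOfSingularities.Theorems.EquisingularLiftEquisingularLiftNatModelStep
import Summits.ResolutionOfSingularities.ResolutionOfSingularities.Theorems.EquisingularLiftEquisingularLiftNatConeRoundTransport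
import Summits.ResolutionOfSingularities.ResolutionOfSingularities.Theorems.EquisingularLiftEquisingularLiftNatExactShadowSection
import HarnessLib

/-!
# [OURS · L1 W4.5(b) · EL♮(3) · door ν4, D7 brick HNODE] GENERIC TOOLS FOR THE NOSE'S SECTION STEP

res-L1-w45b-stub-2 g17 (STUB WORKER 2; HNODE pen-designate, desk l.84094 / nose-w1 l.84115).  `--supports stmt-ResolutionOfSingularities-20148
--as helper`, no claim, counted 0.  OURS; NOT a statement of [Hironaka2017] (a candidate under adjudication); AI-written, weaker than expert review.
EL♮(3) is NOT proved here; resolution of singularities in positive characteristic is NOT proved anywhere in this tree.  DEF-FREE.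

HNODE (`hnode_rPlus`, nose-w1's SIG 88f95984ac61be35) steps the equinodal nose datum through the blow-up of ONE node SECTION.  This file holds the
pieces of that step which do not depend on the final spelling of DefsE3 (`NoseDatum`/`RPlus`/`SplitNodeAt`, draft 8d1decef73adac13):

* (P1) **sections away from the centre lift** — `exists_lift_of_disjoint_support` (a morphism `f : S ⟶ X` whose image misses `supp C` lifts uniquely
  through a blow-up `τ` of `C`: `C·𝒪_S = (1)` is an effective Cartier divisor), and **keep their vanishing**: `strictTransformIdeal_le_ker_of_le_ker`
  (`K ≤ ker f ⇒ St_τ K ≤ ker f₁` — `f` factors through `V(K)`, whose strict transform is a blow-up of `V(K)`, Stacks 080E in the tree's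
  `isBlowup_subscheme_strictTransformIdeal_of_idealSheaf`; lift there and use uniqueness of lifts through `τ`);
* (P2) **the split-node package transports along ring isomorphisms** — `exists_splitNode_map_of_ringEquiv` (pure algebra: the ∃-package
  «`I_S = I_L ⊔ (u,v)`, `I_W = I_L ⊔ (g)`, `g = a u² + b uv + c v² + h`, `h ∈ I_L ⊔ (u,v)³`, `b² − 4ac` a unit» is preserved by `Ideal.map` along a
  `RingEquiv`), and its scheme form OFF THE CENTRE of a blow-up — `stalkIdeal_strictTransformIdeal_eq_map_of_not_mem'` /
  `stalkIdeal_ker_lift_eq_map` (the three stalk ideals at `f₁ p` are the images of those at `f p` under the stalk isomorphism `τ^♯`);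
* (P4) **regular special fibre + flat ⇒ regular, for a closed subscheme** — `isRegularLocalRing_subscheme_of_model_of_flat`: res-L1-w45b-stub-1's
  K7 `isRegularLocalRing_of_model_of_flat` applied to the model square OF `V(𝓦)` (`isPullback_subschemeMap` pasted under the stage square).

References: U. Görtz, T. Wedhorn, *Algebraic Geometry I* (2nd ed. 2020), Def. 13.90, Prop. 13.91 [GortzWedhorn2020]; The Stacks Project, Tags 080E,
02OS, 0805 [StacksProject]; H. Matsumura, *Commutative Ring Theory* (1986), Thm. 14.2 and §7 [Matsumura1987].
-/

set_option linter.dupNamespace false -- mandated namespace `Summit.<Summit>.<Problem>` of this single-conjunct summit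
set_option linter.overlappingInstances false -- signatures carry `[IsDomain O] [IsDiscreteValuationRing O]`

noncomputable section

open CategoryTheory CategoryTheory.Limits AlgebraicGeometry TopologicalSpace Topology IsLocalRing
open Literature.AlgebraicGeometry.Resolution
open AlgebraicGeometry.Scheme.IdealSheafData

namespace Summit.ResolutionOfSingularities.ResolutionOfSingularities.Cruxes.EquisingularLiftNat.Sections

universe u

/-! ## (P1) Sections away from the centre lift through the blow-up and keep their vanishing -/

section Lift

variable {X X₁ S : Scheme.{u}} {τ : X₁ ⟶ X} {C : X.IdealSheafData}

/-- An ideal sheaf pulls back to the unit ideal along a morphism whose image misses its support. [folklore] -/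
theorem comap_eq_top_of_disjoint_support (f : S ⟶ X) (hf : Disjoint (Set.range f) (C.support : Set X)) : C.comap f = ⊤ := by
  rw [← Scheme.IdealSheafData.support_eq_bot_iff]
  ext s
  simp only [Scheme.IdealSheafData.support_comap, Closeds.coe_preimage, Set.mem_preimage, Closeds.coe_bot, Set.mem_empty_iff_false,
    iff_false]
  exact fun hs => Set.disjoint_left.mp hf (Set.mem_range_self s) hs

/-- **(P1a) A morphism missing the centre lifts through the blow-up** (`C·𝒪_S = (1)` is an effective Cartier divisor, universal property),
uniquely. [cite: GortzWedhorn2020, Def. 13.90 p. 413] -/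
theorem exists_lift_of_disjoint_support (hτ : IsBlowup τ C) (f : S ⟶ X) (hf : Disjoint (Set.range f) (C.support : Set X)) :
    ∃ f₁ : S ⟶ X₁, f₁ ≫ τ = f ∧ ∀ g : S ⟶ X₁, g ≫ τ = f → g = f₁ := by
  have hcart : IsEffectiveCartier (C.comap f) := by
    rw [comap_eq_top_of_disjoint_support f hf]; exact isEffectiveCartier_top
  exact ⟨hτ.lift f hcart, hτ.lift_comp f hcart, fun g hg => hτ.lift_unique f hcart hg⟩

/-- The lift misses the exceptional divisor. [folklore] -/
theorem range_lift_disjoint_support_comap {f : S ⟶ X} (hf : Disjoint (Set.range f) (C.support : Set X)) {f₁ : S ⟶ X₁}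
    (hf₁ : f₁ ≫ τ = f) : Disjoint (Set.range f₁) ((C.comap τ).support : Set X₁) := by
  rw [Scheme.IdealSheafData.support_comap]
  refine Set.disjoint_left.mpr ?_
  rintro _ ⟨s, rfl⟩ hs
  refine Set.disjoint_left.mp hf (Set.mem_range_self s) ?_
  have : τ (f₁ s) = f s := by rw [← Scheme.Hom.comp_apply, hf₁]
  simpa [this] using hs

/-- **(P1b) The lift keeps the vanishing: `K ≤ ker f ⇒ St_τ K ≤ ker f₁`.** `f` factors through `V(K)`; the strict transform `V(St K) → V(K)` is a
blow-up of `V(K)` along `C|_{V(K)}` (Stacks 080E), along which the factor of `f` pulls the centre back to `(1)`, so it lifts to `V(St K)`; by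
uniqueness of lifts through `τ` this lift IS `f₁`, which therefore factors through `V(St K)`. [cite: StacksProject, Tag 080E]
[cite: GortzWedhorn2020, Prop. 13.91 (1) p. 414] -/
theorem strictTransformIdeal_le_ker_of_le_ker [IsLocallyNoetherian X] (hτ : IsBlowup τ C) {f : S ⟶ X}
    (hf : Disjoint (Set.range f) (C.support : Set X)) {f₁ : S ⟶ X₁} (hf₁ : f₁ ≫ τ = f)
    (K : X.IdealSheafData) (hK : K ≤ f.ker) : strictTransformIdeal τ C K ≤ f₁.ker := by
  -- `f` factors through `V(K)`
  have hker : K.subschemeι.ker ≤ f.ker := by rwa [Scheme.IdealSheafData.ker_subschemeι]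
  set f' : S ⟶ K.subscheme := IsClosedImmersion.lift K.subschemeι f hker with hf'
  have hf'ι : f' ≫ K.subschemeι = f := IsClosedImmersion.lift_fac _ _ hker
  -- the strict transform of `V(K)` is a blow-up of `V(K)` along `C|_{V(K)}`
  obtain ⟨πS, hπS⟩ := exists_hom_subscheme_strictTransformIdeal_of_idealSheaf τ C K
  have hbl := isBlowup_subscheme_strictTransformIdeal_of_idealSheaf hτ πS hπS
  -- along `f'` that centre is the unit ideal
  have hcart : IsEffectiveCartier ((C.comap K.subschemeι).comap f') := by
    rw [← Scheme.IdealSheafData.comap_comp, hf'ι, comap_eq_top_of_disjoint_support f hf]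
    exact isEffectiveCartier_top
  set g := hbl.lift f' hcart with hg
  have hgπ : g ≫ πS = f' := hbl.lift_comp f' hcart
  -- the composite `g ≫ ι_{St K}` is a lift of `f` through `τ`, hence equals `f₁`
  have hcomp : (g ≫ (strictTransformIdeal τ C K).subschemeι) ≫ τ = f := by
    rw [Category.assoc, ← hπS, ← Category.assoc, hgπ, hf'ι]
  obtain ⟨f₁', -, huniq⟩ := exists_lift_of_disjoint_support hτ f hf
  have h1 : g ≫ (strictTransformIdeal τ C K).subschemeι = f₁ := by rw [huniq _ hcomp, huniq _ hf₁]
  -- so `f₁` kills `St K`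
  rw [← h1, ← Scheme.IdealSheafData.map_ker]
  calc strictTransformIdeal τ C K = (strictTransformIdeal τ C K).subschemeι.ker := (Scheme.IdealSheafData.ker_subschemeι _).symm
    _ = Scheme.IdealSheafData.map ⊥ (strictTransformIdeal τ C K).subschemeι := (Scheme.IdealSheafData.map_bot _).symm
    _ ≤ Scheme.IdealSheafData.map g.ker (strictTransformIdeal τ C K).subschemeι := Scheme.IdealSheafData.map_mono _ bot_le

end Lift

/-! ## (P2) The split-node package transports along ring isomorphisms -/

section SplitNode

/-- **(P2, algebra) The split-node ∃-package is preserved by `Ideal.map` along a ring isomorphism.** [folklore] -/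
theorem exists_splitNode_map_of_ringEquiv {R R' : Type u} [CommRing R] [CommRing R'] (φ : R ≃+* R') (IL IW IS : Ideal R)
    (h : ∃ (u v g a b c h : R), IS = IL ⊔ Ideal.span {u, v} ∧ IW = IL ⊔ Ideal.span {g} ∧
      g = a * u ^ 2 + b * u * v + c * v ^ 2 + h ∧ h ∈ IL ⊔ Ideal.span {u, v} ^ 3 ∧ IsUnit (b ^ 2 - 4 * a * c)) :
    ∃ (u v g a b c h : R'), IS.map φ.toRingHom = IL.map φ.toRingHom ⊔ Ideal.span {u, v} ∧
      IW.map φ.toRingHom = IL.map φ.toRingHom ⊔ Ideal.span {g} ∧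
      g = a * u ^ 2 + b * u * v + c * v ^ 2 + h ∧ h ∈ IL.map φ.toRingHom ⊔ Ideal.span {u, v} ^ 3 ∧ IsUnit (b ^ 2 - 4 * a * c) := by
  obtain ⟨u, v, g, a, b, c, h, hS, hW, hg, hh, hunit⟩ := h
  refine ⟨φ u, φ v, φ g, φ a, φ b, φ c, φ h, ?_, ?_, ?_, ?_, ?_⟩
  · rw [hS, Ideal.map_sup, Ideal.map_span, Set.image_pair]; rfl
  · rw [hW, Ideal.map_sup, Ideal.map_span, Set.image_singleton]; rfl
  · rw [hg]; simp [map_add, map_mul, map_pow]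
  · have := Ideal.mem_map_of_mem φ.toRingHom hh
    rw [Ideal.map_sup, Ideal.map_pow, Ideal.map_span, Set.image_pair] at this
    exact this
  · have := hunit.map φ.toRingHom
    simpa [map_sub, map_mul, map_pow, map_ofNat] using this

variable {X X₁ : Scheme.{u}} {τ : X₁ ⟶ X} {C : X.IdealSheafData}

/-- **(P2, stalk ideals off the centre)** For a blow-up `τ` of `C` and a point `x₁` off the exceptional divisor, the stalk of a strict transform
`St_τ K` at `x₁` is the image of `K_{τ x₁}` under the stalk ISOMORPHISM `τ^♯_{x₁}` (tree `stalkIdeal_strictTransformIdeal_of_not_mem`, restated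
with the `RingEquiv`). [cite: StacksProject, Tag 02OS] -/
theorem stalkIdeal_strictTransformIdeal_eq_map_ringEquiv [IsLocallyNoetherian X₁] (hτ : IsBlowup τ C) (K : X.IdealSheafData) {x₁ : X₁}
    (hx₁ : x₁ ∉ ((C.comap τ).support : Set X₁)) :
    haveI := hτ.isIso_stalkMap_of_not_mem_exceptional hx₁
    stalkIdeal (strictTransformIdeal τ C K) x₁ = (stalkIdeal K (τ x₁)).map (asIso (τ.stalkMap x₁)).commRingCatIsoToRingEquiv.toRingHom := by
  rw [stalkIdeal_strictTransformIdeal_of_not_mem τ C K hx₁]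
  rfl

/-- **(P2, the section's ideal)** For a closed immersion `f₁ : S ⟶ X₁` with `f₁ ≫ τ = f` a closed immersion too, at a point `p` with `f₁ p` off the
exceptional divisor: `(ker f₁)_{f₁ p} = τ^♯ ((ker f)_{f p})`. [folklore] -/
theorem stalkIdeal_ker_eq_map_of_comp {S : Scheme.{u}} (hτ : IsBlowup τ C) (f₁ : S ⟶ X₁) [IsClosedImmersion f₁] (f : S ⟶ X)
    [IsClosedImmersion f] (hf₁ : f₁ ≫ τ = f) (p : S) (hp : f₁ p ∉ ((C.comap τ).support : Set X₁)) :
    haveI := hτ.isIso_stalkMap_of_not_mem_exceptional hp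
    stalkIdeal f₁.ker (f₁ p) =
      (stalkIdeal f.ker (τ (f₁ p))).map (asIso (τ.stalkMap (f₁ p))).commRingCatIsoToRingEquiv.toRingHom := by
  haveI := hτ.isIso_stalkMap_of_not_mem_exceptional hp
  subst hf₁
  set e := (asIso (τ.stalkMap (f₁ p))).commRingCatIsoToRingEquiv with he
  rw [stalkIdeal_ker_eq_ker_stalkMap f₁ p]
  have h2 : stalkIdeal (f₁ ≫ τ).ker (τ (f₁ p)) = RingHom.ker ((f₁ ≫ τ).stalkMap p).hom :=
    stalkIdeal_ker_eq_ker_stalkMap (f₁ ≫ τ) p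
  rw [h2, Scheme.Hom.stalkMap_comp]
  change RingHom.ker (f₁.stalkMap p).hom = (RingHom.ker ((f₁.stalkMap p).hom.comp (τ.stalkMap (f₁ p)).hom)).map e.toRingHom
  rw [← RingHom.comap_ker]
  have hsurj : Function.Surjective e.toRingHom := e.surjective
  have : (τ.stalkMap (f₁ p)).hom = e.toRingHom := rfl
  rw [this, Ideal.map_comap_of_surjective _ hsurj]

end SplitNode

/-! ## (P4) Regular special fibre + flat ⇒ regular, for a closed subscheme in a model square -/

section FibreRegular

/-- **(P4) `V(𝓦)` flat over the DVR with regular special fibre at `z` is regular at the point over `z`.**  In a model square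
`IsPullback j t r (Spec θ)` (`θ : O ↠ k`), for an ideal sheaf `𝓦` on the locally Noetherian `X` with `V(𝓦) → Spec O` flat, the square
`V(𝓦·𝒪_F) → V(𝓦)` over `F → X` is again a model square (`isPullback_subschemeMap` pasted under the stage square), so res-L1-w45b-stub-1's K7
`isRegularLocalRing_of_model_of_flat` applies: if `V(𝓦·𝒪_F)` is regular at `z` then `V(𝓦)` is regular at the corresponding point.
[cite: Matsumura1987, Thm. 14.2 and §7] -/
theorem isRegularLocalRing_subscheme_of_model_of_flat (O : Type) [CommRing O] [IsDomain O] [IsDiscreteValuationRing O]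
    (k : Type) [Field k] (θ : O →+* k) (hθ : Function.Surjective θ) {X F : Scheme.{0}} (r : X ⟶ Spec (.of O))
    [IsLocallyNoetherian X] (j : F ⟶ X) (t : F ⟶ Spec (.of k)) (hsq : IsPullback j t r (Spec.map (CommRingCat.ofHom θ)))
    (𝓦 : X.IdealSheafData) [Flat (𝓦.subschemeι ≫ r)] (z : ↥(𝓦.comap j).subscheme)
    (hz : IsRegularLocalRing ((𝓦.comap j).subscheme.presheaf.stalk z)) :
    IsRegularLocalRing (𝓦.subscheme.presheaf.stalk (subschemeMap (𝓦.comap j) 𝓦 j (𝓦.le_map_comap j) z)) := by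
  have hsq' : IsPullback (subschemeMap (𝓦.comap j) 𝓦 j (𝓦.le_map_comap j)) ((𝓦.comap j).subschemeι ≫ t) (𝓦.subschemeι ≫ r)
      (Spec.map (CommRingCat.ofHom θ)) :=
    (isPullback_subschemeMap j 𝓦).paste_vert hsq
  haveI : IsLocallyNoetherian 𝓦.subscheme := LocallyOfFiniteType.isLocallyNoetherian 𝓦.subschemeι
  exact isRegularLocalRing_of_model_of_flat O k θ hθ (𝓦.subschemeι ≫ r) _ _ hsq' z hz

end FibreRegular

/-! ## (R1) Integrality of the strict transform of an integral closed subscheme -/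

section Integral

variable {X X₁ : Scheme.{u}} {τ : X₁ ⟶ X} {C : X.IdealSheafData}

/-- A point of `V(K)` off `supp C` shows `C|_{V(K)} ≠ ⊥`. [folklore] -/
theorem comap_subschemeι_ne_bot_of_not_subset (C K : X.IdealSheafData) (h : ¬ ((K.support : Set X) ⊆ C.support)) :
    C.comap K.subschemeι ≠ ⊥ := by
  intro hbot
  apply h
  intro x hx
  rw [← Scheme.IdealSheafData.range_subschemeι] at hx
  obtain ⟨y, rfl⟩ := hx
  have hy : y ∈ ((C.comap K.subschemeι).support : Set K.subscheme) := by
    rw [hbot, Scheme.IdealSheafData.support_bot]; trivial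
  rw [Scheme.IdealSheafData.support_comap] at hy
  exact hy

/-- **(R1) The strict transform of an INTEGRAL closed subscheme `V(K)` not contained in the centre is integral**: `V(St K) → V(K)` is a blow-up
of `V(K)` along `C|_{V(K)} ≠ ⊥` (Stacks 080E), and blow-ups of integral schemes in non-zero centres are integral.
[cite: StacksProject, Tag 080E] [cite: StacksProject, Tag 02ND] -/
theorem isIntegral_subscheme_strictTransformIdeal [IsLocallyNoetherian X] (hτ : IsBlowup τ C) (K : X.IdealSheafData)
    [IsIntegral K.subscheme] (hK : ¬ ((K.support : Set X) ⊆ C.support)) : IsIntegral (strictTransformIdeal τ C K).subscheme := by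
  obtain ⟨πS, hπS⟩ := exists_hom_subscheme_strictTransformIdeal_of_idealSheaf τ C K
  exact (isBlowup_subscheme_strictTransformIdeal_of_idealSheaf hτ πS hπS).isIntegral (comap_subschemeι_ne_bot_of_not_subset C K hK)

end Integral

/-! ## (P1d) Points of the new special fibre under the lifted sections; closedness off the centre -/

section Points

variable {O : Type} [CommRing O] [IsLocalRing O] {k : Type} [Field k] (θ : O →+* k)

/-- **A section's closed point lies in the special fibre** of a model square. [folklore] -/
theorem exists_eq_section_closedPoint (hθ : Function.Surjective θ) {X F : Scheme.{0}} (r : X ⟶ Spec (.of O)) (j : F ⟶ X)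
    (t : F ⟶ Spec (.of k)) (hsq : IsPullback j t r (Spec.map (CommRingCat.ofHom θ))) (f : Spec (.of O) ⟶ X) (hf : f ≫ r = 𝟙 _) :
    ∃ w : F, j w = f (closedPoint O) := by
  have hmem : f (closedPoint O) ∈ Set.range j := by
    rw [range_eq_preimage_of_isPullback hsq, range_specMap_of_surjective_of_field θ hθ]
    show r (f (closedPoint O)) ∈ ({closedPoint O} : Set _)
    rw [← Scheme.Hom.comp_apply, hf]; rfl
  obtain ⟨w, hw⟩ := hmem
  exact ⟨w, hw⟩

/-- **The lifted section's special point lies over the old one**: in commuting model squares `j₁ ≫ τ = υ ≫ j`, if `f₁ ≫ τ = f`, `j w = f 𝔪` and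
`j₁ w₁ = f₁ 𝔪`, then `υ w₁ = w` (`j` is injective). [folklore] -/
theorem apply_eq_of_section_lift {X X₁ F F₁ : Scheme.{0}} {τ : X₁ ⟶ X} {υ : F₁ ⟶ F} (j : F ⟶ X) [IsClosedImmersion j] (j₁ : F₁ ⟶ X₁)
    (hcomm : j₁ ≫ τ = υ ≫ j) {f : Spec (.of O) ⟶ X} {f₁ : Spec (.of O) ⟶ X₁} (hf₁ : f₁ ≫ τ = f) {w : F} {w₁ : F₁}
    (hw : j w = f (closedPoint O)) (hw₁ : j₁ w₁ = f₁ (closedPoint O)) : υ w₁ = w := by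
  apply j.isClosedEmbedding.injective
  rw [← Scheme.Hom.comp_apply, ← hcomm, Scheme.Hom.comp_apply, hw₁, ← Scheme.Hom.comp_apply, hf₁, hw]

/-- Off the centre a blow-up is injective, so a point over a closed point off the centre is closed. [cite: GortzWedhorn2020, Prop. 13.91 (3)] -/
theorem isClosed_singleton_of_isBlowup_of_not_mem {G G₁ : Scheme.{0}} {υ : G₁ ⟶ G} {J : G.IdealSheafData} (hυ : IsBlowup υ J) {w₁ : G₁}
    (hw : υ w₁ ∉ (J.support : Set G)) (hcl : IsClosed ({υ w₁} : Set G)) : IsClosed ({w₁} : Set G₁) := by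
  have : ({w₁} : Set G₁) = υ ⁻¹' {υ w₁} := by
    ext z
    simp only [Set.mem_singleton_iff, Set.mem_preimage]
    exact ⟨fun h => by rw [h], fun h => eq_of_apply_eq_of_not_mem_of_isBlowup hυ h (by rw [h]; exact hw)⟩
  rw [this]
  exact hcl.preimage υ.continuous

end Points

/-! ## Sections through distinct closed points are disjoint -/

section Disjoint

variable {O : Type} [CommRing O] [IsDomain O] [IsDiscreteValuationRing O]

/-- **Two sections of `X → Spec O` (`O` a DVR) with closed range and DISTINCT closed values have disjoint images.**  If `s₁ a = s₂ b` then `a = b`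
(apply `r`); `a` is not the closed point by hypothesis; if `a = η` then `s₁ 𝔪 ∈ closure {s₁ η} = closure {s₂ η} ⊆ range s₂ = {s₂ η, s₂ 𝔪}`, and
`s₁ 𝔪 ≠ s₂ η` (apply `r`), so `s₁ 𝔪 = s₂ 𝔪` — contradiction (the two points of `Spec O`: tree `eq_closedPoint_or_eq_bot`). [folklore] -/
theorem disjoint_range_of_sections {X : Scheme.{0}} (r : X ⟶ Spec (.of O)) (s₁ s₂ : Spec (.of O) ⟶ X) (h₁ : s₁ ≫ r = 𝟙 _)
    (h₂ : s₂ ≫ r = 𝟙 _) (hcl : IsClosed (Set.range s₂)) (hne : s₁ (closedPoint O) ≠ s₂ (closedPoint O)) :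
    Disjoint (Set.range s₁) (Set.range s₂) := by
  have hr₁ : ∀ a, r (s₁ a) = a := fun a => by rw [← Scheme.Hom.comp_apply, h₁]; rfl
  have hr₂ : ∀ a, r (s₂ a) = a := fun a => by rw [← Scheme.Hom.comp_apply, h₂]; rfl
  refine Set.disjoint_left.mpr ?_
  rintro _ ⟨a, rfl⟩ ⟨b, hb⟩
  have hab : b = a := by rw [← hr₂ b, hb, hr₁]
  subst hab
  rcases eq_closedPoint_or_eq_bot (O := O) b with rfl | rfl
  · exact hne hb.symm
  · -- the generic points agree; specialise to the closed point inside the closed `range s₂`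
    set η : Spec (.of O) := ⟨⊥, Ideal.isPrime_bot⟩ with hη
    have hspec : η ⤳ closedPoint O := IsLocalRing.specializes_closedPoint η
    have h1 : s₁ η ⤳ s₁ (closedPoint O) := hspec.map s₁.continuous
    have hmem : s₁ (closedPoint O) ∈ Set.range s₂ :=
      hcl.closure_subset_iff.mpr (Set.singleton_subset_iff.mpr ⟨η, hb⟩) (specializes_iff_mem_closure.mp h1)
    obtain ⟨c, hc⟩ := hmem
    rcases eq_closedPoint_or_eq_bot (O := O) c with rfl | rfl
    · exact hne hc.symm
    · have : (η : Spec (.of O)) = closedPoint O := by rw [← hr₂ η, hc, hr₁]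
      exact absurd (congrArg PrimeSpectrum.asIdeal this) (by
        change (⊥ : Ideal O) ≠ maximalIdeal O
        exact (IsDiscreteValuationRing.not_a_field' (R := O)).symm)

end Disjoint

end Summit.ResolutionOfSingularities.ResolutionOfSingularities.Cruxes.EquisingularLiftNat.Sections

end
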